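import Literature.Geometry.Symplectic.AkbulutMatveyev
import Literature.Geometry.Symplectic.SteinBall
import Literature.Topology.FourManifolds.ClosedBallProofs
import HarnessLib

/-!
# The convex decomposition of the 4-sphere: `S⁴ = B⁴ ∪_{S³} B⁴` with both pieces Stein (proved)

Sibling file of `AkbulutMatveyev.lean` (fact `Literature.Geometry.Symplectic.akbulut_matveyev`,
Akbulut–Matveyev 1998: every closed oriented smooth 4-manifold is a closed gluing of two compact
Stein domains along a boundary relation).  The simplest instance of its conclusion is now a
**theorem**: the round sphere `S⁴` is the double of the closed unit ball
(`Literature.Topology.FourManifolds.isDouble_sphere_holds`, `ClosedBallProofs.lean`: the two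
hemisphere embeddings `𝔻⁴ ↪ S⁴` form a closed gluing meeting exactly along the equator
`∂𝔻⁴ = S³`), and the closed unit ball `B⁴ ⊂ ℂ²` carries the standard Stein structure
(`Literature.Geometry.Symplectic.isSteinDomain_closedBall`, `SteinBall.lean`).  So
`S⁴ = B⁴ ∪_{S³} B⁴` is an Akbulut–Matveyev decomposition (the decomposition whose existence for
*homotopy* 4-spheres, with `∂ = S³`, is crux 2 of the route `SmoothPoincare4/SymplecticCap`).

* `isBoundaryRelation_double_closedBall` — the gluing relation of a double of `𝔻⁴` (points of
  `∂𝔻⁴ = S³` identified with themselves) is a boundary relation (`IsBoundaryRelation`);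
* `akbulut_matveyev_sphere` — the conclusion of `akbulut_matveyev` for `X = S⁴`, unconditionally.

## References

* S. Akbulut, R. Matveyev, *A convex decomposition theorem for 4-manifolds*, IMRN 1998, no. 7,
  371–381 (arXiv:math/0010166), abstract and Thm. 2 (1). [AkbulutMatveyev1998]
-/

noncomputable section

open scoped Manifold ContDiff
open Set Function Metric

namespace Literature.Geometry.Symplectic

open Literature.Topology.FourManifolds

/-- **The gluing relation of the double of `𝔻⁴` is a boundary relation**: it only relates the
point `incl z ∈ ∂𝔻⁴` to itself (`z ∈ S³`), and `range incl = ∂𝔻⁴`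
(`range_inclusion_eq_boundary`). [folklore] -/
theorem isBoundaryRelation_double_closedBall :
    IsBoundaryRelation (Metric.closedBall (0 : EuclideanSpace ℝ (Fin 4)) 1)
      (Metric.closedBall (0 : EuclideanSpace ℝ (Fin 4)) 1) fun x y =>
      ∃ z, x = (closedBallBoundaryData 3).incl z ∧ y = (closedBallBoundaryData 3).incl (id z) := by
  rintro x y ⟨z, rfl, rfl⟩
  have hz : (closedBallBoundaryData 3).incl z ∈
      (𝓡∂ 4).boundary (Metric.closedBall (0 : EuclideanSpace ℝ (Fin 4)) 1) := by
    rw [← (closedBallBoundaryData 3).range_incl]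
    exact mem_range_self z
  exact ⟨hz, hz⟩

/-- **The convex decomposition of `S⁴` (Akbulut–Matveyev for `X = S⁴`, proved):** the round
4-sphere is a closed gluing of two compact Stein domains — two copies of the closed unit ball
`B⁴ ⊂ ℂ²` with its standard Stein structure (`isSteinDomain_closedBall`) — along a boundary
relation (the identification of the two boundary 3-spheres, `isDouble_sphere_holds`).  This is
the conclusion of the named fact `akbulut_matveyev` for `X = S⁴`, unconditionally.
[cite: AkbulutMatveyev1998, abstract and Thm. 2 (1)] -/
theorem akbulut_matveyev_sphere :
    ∃ (W₁ W₂ : Type) (_ : TopologicalSpace W₁) (_ : ChartedSpace (EuclideanHalfSpace 4) W₁)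
      (_ : IsManifold (𝓡∂ 4) ∞ W₁) (_ : CompactSpace W₁)
      (_ : TopologicalSpace W₂) (_ : ChartedSpace (EuclideanHalfSpace 4) W₂)
      (_ : IsManifold (𝓡∂ 4) ∞ W₂) (_ : CompactSpace W₂) (R : W₁ → W₂ → Prop),
      IsSteinDomain W₁ ∧ IsSteinDomain W₂ ∧ IsBoundaryRelation W₁ W₂ R ∧
        IsClosedGluing (𝓡∂ 4) (𝓡∂ 4) (𝓡 4) (P := Metric.sphere (0 : EuclideanSpace ℝ (Fin (4 + 1))) 1) R :=
  ⟨Metric.closedBall (0 : EuclideanSpace ℝ (Fin 4)) 1, Metric.closedBall (0 : EuclideanSpace ℝ (Fin 4)) 1,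
    _, _, _, _, _, _, _, _, _, isSteinDomain_closedBall, isSteinDomain_closedBall,
    isBoundaryRelation_double_closedBall, isDouble_sphere_holds⟩

end Literature.Geometry.Symplectic

end
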